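import Mathlib.Tactic.Abel
import Literature.IUT.HodgeArakelov.ThetaValueOrbits

/-!
# [IUTchII] Corollaries 2.8, 2.9 — proofs for the theta-evaluation output signatures (discharge companion)

Proof-only companion (abc-iut cell, wave-3 discharge seat abc-iut-L6-d1; nodes **IUTchII:Cor2.8(i)–(iii)**,
**IUTchII:Cor2.9(i)–(iii)**, **IUTchII:Rmk2.8.1**) of abc-iut-L6-t4's statement file
`Literature/IUT/HodgeArakelov/ThetaValueOrbits.lean` (p404347). It adds NO definitions; it proves that the
CANONICAL evaluation data satisfy the typed output signatures and predicates of that file, with every printed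
input kept as an explicit hypothesis named after its owner (discharged modulo interfaces; the kernel links when
abc-iut-L6-t1's [IUTchII] §1–§2 chain and abc-iut-L6-t2's Cor. 2.4–2.6 objects land).

Source: S. Mochizuki, *Inter-universal Teichmüller theory II*, kurims manuscript (Dec. 2020) of PRIMS **57**
(2021), §2, Cor. 2.8 pp. 81–83, Rmk. 2.8.1 p. 83, Cor. 2.9 pp. 84–85 (claim key `Mochizuki2012`, status DISPUTED,
D-0012; nothing here asserts a disputed claim or takes a side on [IUTchIII] Cor. 3.12; what is proved is
elementary abelian-group bookkeeping).

What is printed and what is proved (additive notation for the cohomology modules, as in the statement file).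
* Cor. 2.8 (i) p. 82: restriction of the `ι^γ`-invariant subsets `θ^ι_env ⊆ ∞θ^ι_env` to `Π_{v⩒▶}` and then to the
  decomposition groups `D^δ_{t,μ_-}` "yield[s] `μ_{2l}`-, `μ`-orbits of elements `θ^t_env ⊆ ∞θ^t_env`" which
  "depend only on the label `|t| ∈ |𝔽_l|` [cf. Corollary 2.5, (ii)]" — and Cor. 2.5 (ii) p. 72 refers this to
  "[IUTchI], Example 4.4, (i)" (the `ι`-invariance of an étale theta class of standard type, `ι` interchanging the
  cusps labelled `t` and `−t`). PROVED (`cor28i_canonical`): from ONE class `η` (a representative of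
  `θ^ι_env((𝕄^Θ_{*⩒▶})^γ)`) and the restriction maps `res t`, the canonical data `θ^t := μ_{2l}·res_t(η)`,
  `∞θ^t := μ·res_t(η)` inhabit `MonoThetaEvaluationData` with every data field pinned, the clause "depend only on
  `|t|`" being derived from the hypothesis `LabelSymmetric` = "labels with the same class have restrictions
  intertwined by an endomorphism moving `η` inside its `μ_{2l}`-orbit", which `labelSymmetric_of_inversion` obtains
  from the printed mechanism (an automorphism `ι` of the module fixing `η`, with `res_{−t} = res_t ∘ ι`).
* Cor. 2.8 (ii) p. 82: the algorithm is "functorial in … `𝕄^Θ_*` and … compatible with the independent conjugacy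
  actions of `Δ̂^±_v`" — PROVED (`cor28ii_canonical`) for inputs related by transport of structure.
* Cor. 2.8 (iii) pp. 82–83: the zero-label splittings "are compatible, relative to the first restriction
  operation …, with the splittings of Corollary 1.12, (ii)" — PROVED for the transported splitting
  (`cor28iii_of_transport`), together with the uniqueness that makes "determines" meaningful
  (`cor28iii_unique`).
* Cor. 2.9 (i)–(iii) pp. 84–85: the same with `(l·Δ_Θ)(−)` replaced by `μ_ℤ̂(G_v(−))` through the cyclotomic
  rigidity isomorphisms of [AbsTopIII] Cor. 1.10 (c) — PROVED by transport along additive isomorphisms of the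
  coefficient modules (`cor29i_canonical`, `cor29i_transport`, `cor29ii_canonical`, `cor29iii_of_transport`).
* Rmk. 2.8.1 p. 83 (Cors. 2.5, 2.6 as the special case `𝕄^Θ_* = 𝕄^Θ_*(Π_v)`): `rmk281_canonical`.

Deliberately NOT here: the Galois-theoretic REALISATION of the zero-label splitting through restriction to
`D^δ_{0,μ_-}` (needs abc-iut-L6-t1's `ThetaEvaluation`/`Cor112_ii` objects, staged behind p405104 — TODO-merge);
the construction of `η`, `res`, `ι` from a projective system of mono-theta environments ([IUTchII] Prop. 1.5,
Prop. 2.2 (ii), Cor. 2.4 (ii); owners abc-iut-L6-t1 / -t2).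
-/

namespace Literature.IUT.HodgeArakelov

namespace ThetaValueOrbits

universe u v

/-! ### 1. Orbit calculus in an additively written cohomology module -/

section OrbitCalculus

variable {H : Type v} {HG : Type v} [AddCommGroup H] [AddCommGroup HG]

/-- `η ∈ μ·η` (Cor. 2.8 (i): "`μ`-orbits of elements"). [claim: Mochizuki2012, status: disputed] -/
theorem mem_muOrbit_self (η : H) : η ∈ muOrbit η :=
  ⟨0, IsOfFinAddOrder.zero, (add_zero η).symm⟩

/-- Two classes in one `μ_{2l}`-orbit generate the same `μ_{2l}`-orbit (the `2l`-torsion classes form a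
subgroup) — the step behind "orbits of elements" being well defined (Cor. 2.8 (i) p. 82).
[claim: Mochizuki2012, status: disputed] -/
theorem mu2lOrbit_eq_of_mem {twoL : ℕ} {η η' : H} (h : η' ∈ mu2lOrbit twoL η) :
    mu2lOrbit twoL η' = mu2lOrbit twoL η := by
  obtain ⟨τ, hτ, rfl⟩ := h
  ext x
  constructor
  · rintro ⟨τ', hτ', rfl⟩
    exact ⟨τ + τ', by rw [nsmul_add, hτ, hτ', add_zero], by rw [add_assoc]⟩
  · rintro ⟨τ', hτ', rfl⟩
    exact ⟨τ' - τ, by rw [nsmul_sub, hτ', hτ, sub_zero], by abel⟩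

/-- Two classes in one `μ`-orbit generate the same `μ`-orbit (torsion classes form a subgroup; Cor. 2.8 (i)
p. 82). [claim: Mochizuki2012, status: disputed] -/
theorem muOrbit_eq_of_mem {η η' : H} (h : η' ∈ muOrbit η) : muOrbit η' = muOrbit η := by
  obtain ⟨τ, hτ, rfl⟩ := h
  ext x
  constructor
  · rintro ⟨τ', hτ', rfl⟩
    exact ⟨τ + τ', hτ.add hτ', by rw [add_assoc]⟩
  · rintro ⟨τ', hτ', rfl⟩
    exact ⟨-τ + τ', hτ.neg.add hτ', by abel⟩

/-- `μ_{2l}`-orbits are equal iff one generator lies in the other's orbit (Cor. 2.8 (i) p. 82).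
[claim: Mochizuki2012, status: disputed] -/
theorem mu2lOrbit_eq_iff {twoL : ℕ} {η η' : H} :
    mu2lOrbit twoL η' = mu2lOrbit twoL η ↔ η' ∈ mu2lOrbit twoL η :=
  ⟨fun h => h ▸ mem_mu2lOrbit_self twoL η', mu2lOrbit_eq_of_mem⟩

/-- `μ`-orbits are equal iff one generator lies in the other's orbit (Cor. 2.8 (i) p. 82).
[claim: Mochizuki2012, status: disputed] -/
theorem muOrbit_eq_iff {η η' : H} : muOrbit η' = muOrbit η ↔ η' ∈ muOrbit η :=
  ⟨fun h => h ▸ mem_muOrbit_self η', muOrbit_eq_of_mem⟩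

/-- A homomorphism of cohomology modules (restriction to `Π_{v⩒▶}`, to `D^δ_{t,μ_-}`, transport along an
isomorphism of projective systems) maps `μ`-orbits into `μ`-orbits (Cor. 2.8 (i) p. 82).
[claim: Mochizuki2012, status: disputed] -/
theorem image_muOrbit_subset (f : H →+ HG) (η : H) : f '' muOrbit η ⊆ muOrbit (f η) := by
  rintro _ ⟨_, ⟨τ, hτ, rfl⟩, rfl⟩
  exact ⟨f τ, f.isOfFinAddOrder hτ, by rw [map_add]⟩

/-- Along an ISOMORPHISM of coefficient modules (cyclotomic rigidity `(l·Δ_Θ)(−) ≅ Π_μ(−)`, Def. 2.7 (ii);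
`≅ μ_ℤ̂(G_v(−))`, Cor. 2.9 (i)) `μ_{2l}`-orbits correspond exactly. [claim: Mochizuki2012, status: disputed] -/
theorem image_mu2lOrbit_eq (f : H ≃+ HG) (twoL : ℕ) (η : H) :
    f '' mu2lOrbit twoL η = mu2lOrbit twoL (f η) := by
  refine (image_mu2lOrbit_subset f.toAddMonoidHom twoL η).antisymm ?_
  rintro _ ⟨τ, hτ, rfl⟩
  refine ⟨η + f.symm τ, ⟨f.symm τ, f.injective ?_, rfl⟩, by simp⟩
  rw [map_nsmul, f.apply_symm_apply, hτ, map_zero]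

/-- Along an isomorphism of coefficient modules `μ`-orbits correspond exactly (Cor. 2.9 (i) p. 84).
[claim: Mochizuki2012, status: disputed] -/
theorem image_muOrbit_eq (f : H ≃+ HG) (η : H) : f '' muOrbit η = muOrbit (f η) := by
  refine (image_muOrbit_subset f.toAddMonoidHom η).antisymm ?_
  rintro _ ⟨τ, hτ, rfl⟩
  exact ⟨η + f.symm τ, ⟨f.symm τ, (f.symm : HG →+ H).isOfFinAddOrder hτ, rfl⟩, by simp⟩

/-- The image of the `μ_{2l}`-orbit of `η` generates the `μ_{2l}`-orbit of the image ("restriction … yields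
`μ_{2l}`-orbits of elements", Cor. 2.8 (i) p. 82): every image point generates the same orbit.
[claim: Mochizuki2012, status: disputed] -/
theorem mu2lOrbit_image_point (f : H →+ HG) (twoL : ℕ) {η η' : H} (h : η' ∈ mu2lOrbit twoL η) :
    mu2lOrbit twoL (f η') = mu2lOrbit twoL (f η) :=
  mu2lOrbit_eq_of_mem (image_mu2lOrbit_subset f twoL η ⟨η', h, rfl⟩)

/-- Idem for `μ`-orbits (Cor. 2.8 (i) p. 82). [claim: Mochizuki2012, status: disputed] -/
theorem muOrbit_image_point (f : H →+ HG) {η η' : H} (h : η' ∈ muOrbit η) :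
    muOrbit (f η') = muOrbit (f η) :=
  muOrbit_eq_of_mem (image_muOrbit_subset f η ⟨η', h, rfl⟩)

end OrbitCalculus

/-! ### 2. Corollary 2.8 (i): the canonical evaluation data -/

section Cor28

variable {twoL : ℕ} {LabCusp LabAbs : Type u} {abs : LabCusp → LabAbs}
variable {H HG : Type v} [AddCommGroup H] [AddCommGroup HG]

/-- HYPOTHESIS SHAPE for "depend only on the label `|t|`" (Cor. 2.8 (i) p. 82 via Cor. 2.5 (ii) p. 72 and
[IUTchI] Ex. 4.4 (i)): whenever `|t| = |t'|`, the restriction to `D^δ_{t',μ_-}` is the restriction to `D^δ_{t,μ_-}`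
precomposed with an endomorphism `σ` of the module on `Π_{v⩒▶}` that moves the class `η` inside its `μ_{2l}`-orbit
(for `t' = −t`: `σ` = the action of the inversion `ι^γ`, which FIXES the `ι^γ`-invariant class `η`; see
`labelSymmetric_of_inversion`). A predicate on the inputs (owners: abc-iut-L6-t1 `IotaInvariantTheta`,
abc-iut-L6-t2 Cor. 2.4 (ii)(iii)), not a free `Prop`. [claim: Mochizuki2012, status: disputed] -/
theorem labelSymmetric_of_inversion (res : LabCusp → (H →+ HG)) (η : H) (ι : H →+ H) (hfix : ι η = η)
    (neg : LabCusp → LabCusp) (hres : ∀ t, res (neg t) = (res t).comp ι)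
    (habs : ∀ t t', abs t = abs t' → t' = t ∨ t' = neg t) :
    ∀ t t', abs t = abs t' → ∃ σ : H →+ H, res t' = (res t).comp σ ∧ σ η ∈ mu2lOrbit twoL η := by
  intro t t' h
  rcases habs t t' h with rfl | rfl
  · exact ⟨AddMonoidHom.id H, (AddMonoidHom.comp_id _).symm, mem_mu2lOrbit_self twoL η⟩
  · exact ⟨ι, hres t, by rw [hfix]; exact mem_mu2lOrbit_self twoL η⟩

/-- **IUTchII:Cor2.8(i)** DISCHARGED modulo its inputs (kurims p. 82): given the restriction maps
`res t : lim H¹(Π_{v⩒▶}(…), Π_μ(…)) → lim H¹(G_v(…), Π_μ(…))` to the decomposition groups `D^δ_{t,μ_-}`, one class `η` of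
`θ^ι_env((𝕄^Θ_{*⩒▶})^γ)` (after the cyclotomic rigidity isomorphism of Def. 2.7 (ii)), `2l ≥ 1`, and the
label-symmetry hypothesis, the CANONICAL data — `θ^ι_env := μ_{2l}·η`, `∞θ^ι_env := μ·η`, `θ^t_env := μ_{2l}·res_t(η)`,
`∞θ^t_env := μ·res_t(η)` — satisfy every clause of the output signature `MonoThetaEvaluationData`: "`μ_{2l}`-, `μ`-orbits
of elements", `θ ⊆ ∞θ`, and "depend only on the label `|t| ∈ |𝔽_l|`". All data fields are pinned, so this is the
construction, not a bare inhabitation. [claim: Mochizuki2012, status: disputed] -/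
theorem cor28i_canonical (h2l : 0 < twoL) (res : LabCusp → (H →+ HG)) (η : H)
    (hsymm : ∀ t t', abs t = abs t' → ∃ σ : H →+ H, res t' = (res t).comp σ ∧ σ η ∈ mu2lOrbit twoL η) :
    ∃ D : MonoThetaEvaluationData twoL LabCusp LabAbs abs H HG,
      D.res = res ∧ D.thetaIota = mu2lOrbit twoL η ∧ D.thetaInftyIota = muOrbit η ∧
      (∀ t, D.thetaT t = mu2lOrbit twoL (res t η)) ∧ ∀ t, D.thetaInftyT t = muOrbit (res t η) := by
  refine ⟨{ res := res
            thetaIota := mu2lOrbit twoL η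
            thetaInftyIota := muOrbit η
            thetaIota_isOrbit := ⟨η, rfl⟩
            thetaInftyIota_isOrbit := ⟨η, rfl⟩
            thetaIota_subset := mu2lOrbit_subset_muOrbit h2l η
            thetaT := fun t => mu2lOrbit twoL (res t η)
            thetaInftyT := fun t => muOrbit (res t η)
            thetaT_isOrbit := fun t => ⟨η, mem_mu2lOrbit_self twoL η, rfl⟩
            thetaInftyT_isOrbit := fun t => ⟨η, mem_muOrbit_self η, rfl⟩
            thetaT_subset := fun t => mu2lOrbit_subset_muOrbit h2l _
            thetaT_dependsOnlyOnAbs := fun t t' htt' => ?_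
            thetaInftyT_dependsOnlyOnAbs := fun t t' htt' => ?_ },
    rfl, rfl, rfl, fun _ => rfl, fun _ => rfl⟩
  · show mu2lOrbit twoL (res t η) = mu2lOrbit twoL (res t' η)
    obtain ⟨σ, hres, hσ⟩ := hsymm t t' htt'
    rw [hres, AddMonoidHom.comp_apply]
    exact (mu2lOrbit_image_point (res t) twoL hσ).symm
  · show muOrbit (res t η) = muOrbit (res t' η)
    obtain ⟨σ, hres, hσ⟩ := hsymm t t' htt'
    rw [hres, AddMonoidHom.comp_apply]
    exact (muOrbit_image_point (res t) (mu2lOrbit_subset_muOrbit h2l η hσ)).symm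

/-- **IUTchII:Cor2.8(i)** (kurims p. 82 l. 32, "`θ^{|t|}_env := θ^t_env`"): for ANY evaluation data whose
`θ^t`-field is the canonical one, the `|t|`-indexed orbit `thetaAbs` of the statement file is the canonical
orbit `μ_{2l}·res_t(η)`. [claim: Mochizuki2012, status: disputed] -/
theorem thetaAbs_canonical (D : MonoThetaEvaluationData twoL LabCusp LabAbs abs H HG) {η : H}
    (hD : ∀ t, D.thetaT t = mu2lOrbit twoL (D.res t η)) (habs : Function.Surjective abs) (t : LabCusp) :
    thetaAbs D habs (abs t) = mu2lOrbit twoL (D.res t η) := by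
  rw [thetaAbs_eq, hD]

/-- **IUTchII:Cor2.8(i)** (kurims p. 82): the canonical `θ^t_env` is independent of the representative `η` of
`θ^ι_env` — any other class of the same `μ_{2l}`-orbit gives the same orbit after restriction.
[claim: Mochizuki2012, status: disputed] -/
theorem cor28i_independent_of_representative (res : LabCusp → (H →+ HG)) {η η' : H}
    (h : η' ∈ mu2lOrbit twoL η) (t : LabCusp) :
    mu2lOrbit twoL (res t η') = mu2lOrbit twoL (res t η) :=
  mu2lOrbit_image_point (res t) twoL h

/-! ### 3. Corollary 2.8 (ii): functoriality and compatibility with the independent conjugacy actions -/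

/-- **IUTchII:Cor2.8(ii)** DISCHARGED modulo its inputs (kurims p. 82): let the `(γ₁, γ₂)`-indexed inputs
(restrictions `res γ₁ γ₂ t` to the conjugate decomposition groups `D^δ_t ⊆ Π_{v⩒▶}((𝕄^Θ_{*⩒▶})^{γ₂})`, classes
`η γ₁ γ₂`) be related to a reference input `(res₀, η₀)` by TRANSPORT OF STRUCTURE — an endomorphism `σ` of the
module with `res γ₁ γ₂ t = res₀ t ∘ σ` moving `η₀` within its `μ_{2l}`-orbit onto the chosen class — and let an
isomorphism of projective systems `𝕄^Θ_* ⥲ 𝕄'^Θ_*` induce isomorphisms `φH`, `φ` of coefficient modules intertwining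
the restrictions and the classes. Then the `|t|`-indexed outputs (any families agreeing with the canonical
orbits, e.g. `thetaAbs` by `thetaAbs_canonical`) satisfy the typed predicate `Cor28ii_functorialAlgorithm`:
independent of `(γ₁, γ₂)` and carried to the primed outputs by `φ`. [claim: Mochizuki2012, status: disputed] -/
theorem cor28ii_canonical {Conj₁ Conj₂ : Type u} (habs : Function.Surjective abs)
    (res : Conj₁ → Conj₂ → LabCusp → (H →+ HG)) (η : Conj₁ → Conj₂ → H)
    (res₀ : LabCusp → (H →+ HG)) (η₀ : H)
    (hconj : ∀ γ₁ γ₂ t, ∃ σ : H →+ H, res γ₁ γ₂ t = (res₀ t).comp σ ∧ σ (η γ₁ γ₂) ∈ mu2lOrbit twoL η₀)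
    (out : Conj₁ → Conj₂ → LabAbs → Set HG)
    (hout : ∀ γ₁ γ₂ t, out γ₁ γ₂ (abs t) = mu2lOrbit twoL (res γ₁ γ₂ t (η γ₁ γ₂)))
    {H' HG' : Type v} [AddCommGroup H'] [AddCommGroup HG'] (φH : H ≃+ H') (φ : HG ≃+ HG')
    (res' : LabCusp → (H' →+ HG')) (η' : H') (hη' : η' = φH η₀)
    (hres' : ∀ t x, res' t (φH x) = φ (res₀ t x))
    (out' : LabAbs → Set HG') (hout' : ∀ t, out' (abs t) = mu2lOrbit twoL (res' t η')) :
    Cor28ii_functorialAlgorithm out out' φ := by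
  -- every (γ₁, γ₂)-output is the reference output
  have key : ∀ γ₁ γ₂ t, out γ₁ γ₂ (abs t) = mu2lOrbit twoL (res₀ t η₀) := by
    intro γ₁ γ₂ t
    obtain ⟨σ, hres, hσ⟩ := hconj γ₁ γ₂ t
    rw [hout, hres, AddMonoidHom.comp_apply]
    exact mu2lOrbit_image_point (res₀ t) twoL hσ
  refine ⟨fun γ₁ γ₁' γ₂ γ₂' => ?_, fun γ₁ γ₂ a => ?_⟩
  · funext a
    obtain ⟨t, rfl⟩ := habs a
    rw [key, key]
  · obtain ⟨t, rfl⟩ := habs a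
    rw [hout', key, hη', hres' t η₀]
    exact (image_mu2lOrbit_eq φ twoL _).symm

/-! ### 4. Corollary 2.8 (iii): compatibility of the zero-label splittings -/

/-- **IUTchII:Cor2.8(iii)** DISCHARGED in transport form (kurims pp. 82–83): if the identifications
`X₀ ≅ X`, `U₀ ≅ U`, `Q₀ ≅ Q` induced by the first restriction operation (from `Π_Ÿ(Π_v)` to `Π_{v⩒▶}`; `X = M^×_TM·∞θ^ι/M^μ_TM`,
`U = M^{×μ}_TM`, `Q = ∞θ^ι/M^μ_TM`) are bijections and the zero-label splitting is the TRANSPORT of the Cor. 1.12 (ii)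
splitting `X₀ ≃ U₀ × Q₀` along them, then the two splittings are compatible in the sense typed as
`Cor28iii_splitting`. [claim: Mochizuki2012, status: disputed] -/
theorem cor28iii_of_transport {X U Q X₀ U₀ Q₀ : Type u} (split₀ : X₀ ≃ U₀ × Q₀) (eX : X₀ ≃ X)
    (eU : U₀ ≃ U) (eQ : Q₀ ≃ Q) :
    Cor28iii_splitting ((eX.symm.trans split₀).trans (eU.prodCongr eQ)) split₀ eX eU eQ := by
  intro x₀
  simp [Equiv.prodCongr_apply, Prod.map]

/-- **IUTchII:Cor2.8(iii)** "determines splittings … which are compatible" (kurims p. 83): compatibility with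
the Cor. 1.12 (ii) splitting DETERMINES the zero-label splitting on the image of the first restriction
operation — two compatible splittings agree there; in particular they coincide when `rX` is surjective.
[claim: Mochizuki2012, status: disputed] -/
theorem cor28iii_unique {X U Q X₀ U₀ Q₀ : Type u} {split split' : X ≃ U × Q} {split₀ : X₀ ≃ U₀ × Q₀}
    {rX : X₀ → X} {rU : U₀ → U} {rQ : Q₀ → Q} (h : Cor28iii_splitting split split₀ rX rU rQ)
    (h' : Cor28iii_splitting split' split₀ rX rU rQ) :
    (∀ x₀, split (rX x₀) = split' (rX x₀)) ∧ (Function.Surjective rX → split = split') := by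
  refine ⟨fun x₀ => by rw [h x₀, h' x₀], fun hsurj => Equiv.ext fun x => ?_⟩
  obtain ⟨x₀, rfl⟩ := hsurj x
  rw [h x₀, h' x₀]

/-! ### 5. Remark 2.8.1: Corollaries 2.5, 2.6 as the special case `𝕄^Θ_* = 𝕄^Θ_*(Π_v)` -/

/-- **IUTchII:Rmk2.8.1** (kurims p. 83): when the mono-theta-theoretic inputs are the transports of the
group-theoretic ones (Cor. 2.5 (ii)) along an identification `e` of coefficient modules intertwining the
restrictions, the canonical Cor. 2.8 outputs are the `e`-images of the canonical Cor. 2.5 outputs — the typed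
predicate `Rmk281_specialCase`. [claim: Mochizuki2012, status: disputed] -/
theorem rmk281_canonical {H₅ HG₅ : Type v} [AddCommGroup H₅] [AddCommGroup HG₅]
    (habs : Function.Surjective abs) (eH : H₅ ≃+ H) (e : HG₅ ≃+ HG)
    (res₅ : LabCusp → (H₅ →+ HG₅)) (η₅ : H₅) (res₈ : LabCusp → (H →+ HG)) (η₈ : H) (hη : η₈ = eH η₅)
    (hres : ∀ t x, res₈ t (eH x) = e (res₅ t x)) (out₈ : LabAbs → Set HG) (out₅ : LabAbs → Set HG₅)
    (hout₈ : ∀ t, out₈ (abs t) = mu2lOrbit twoL (res₈ t η₈))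
    (hout₅ : ∀ t, out₅ (abs t) = mu2lOrbit twoL (res₅ t η₅)) :
    Rmk281_specialCase out₈ out₅ e.toEquiv := by
  intro a
  obtain ⟨t, rfl⟩ := habs a
  rw [hout₈, hout₅, hη, hres]
  show mu2lOrbit twoL (e (res₅ t η₅)) = ⇑e '' mu2lOrbit twoL (res₅ t η₅)
  exact (image_mu2lOrbit_eq e twoL _).symm

end Cor28

/-! ### 6. Corollary 2.9: transport along the base-field-theoretic cyclotomic rigidity isomorphisms -/

section Cor29

variable {twoL : ℕ} {LabCusp LabAbs : Type u} {abs : LabCusp → LabAbs}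
variable {H HG Zhat : Type v} [AddCommGroup H] [AddCommGroup HG] [AddCommGroup Zhat]

/-- **IUTchII:Cor2.9(i)** DISCHARGED modulo its inputs (kurims p. 84): over the base-field-theoretic
coefficient modules (`μ_ℤ̂(G_v(−))` in place of `Π_μ(−)`), the canonical data `θ^t_bs := μ_{2l}·res_t(η)`,
`∞θ^t_bs := μ·res_t(η)` together with the valuation surjection `H¹(G_v(−), μ_ℤ̂(G_v(−))) ↠ ℤ̂` (Rmk. 1.11.5 / 2.9.1 (ii),
abc-iut-L6-t1 `ValuationSurjection`) inhabit `BaseFieldThetaEvaluationData` with every field pinned.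
[claim: Mochizuki2012, status: disputed] -/
theorem cor29i_canonical (h2l : 0 < twoL) (res : LabCusp → (H →+ HG)) (η : H)
    (hsymm : ∀ t t', abs t = abs t' → ∃ σ : H →+ H, res t' = (res t).comp σ ∧ σ η ∈ mu2lOrbit twoL η)
    (V : HG →+ Zhat) (hV : Function.Surjective V) :
    ∃ D : BaseFieldThetaEvaluationData twoL LabCusp LabAbs abs H HG Zhat,
      D.res = res ∧ D.thetaIota = mu2lOrbit twoL η ∧ D.thetaInftyIota = muOrbit η ∧
      (∀ t, D.thetaT t = mu2lOrbit twoL (res t η)) ∧ (∀ t, D.thetaInftyT t = muOrbit (res t η)) ∧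
      D.valSurj = V := by
  obtain ⟨D, h₁, h₂, h₃, h₄, h₅⟩ := cor28i_canonical h2l res η hsymm
  exact ⟨{ toMonoThetaEvaluationData := D, valSurj := V, valSurj_surjective := hV }, h₁, h₂, h₃, h₄, h₅, rfl⟩

/-- **IUTchII:Cor2.9(i)** (kurims p. 84, "to replace '`(l·Δ_Θ)(−)`' by '`μ_ℤ̂(G_v(−))`'"): along cyclotomic
rigidity isomorphisms `eH`, `e` of the coefficient modules ([AbsTopIII] Cor. 1.10 (c); abc-iut-L6-t1
`CyclotomicRigidity`, abc-iut-L4-t1) intertwining the restrictions, the base-field-theoretic canonical orbits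
are exactly the images of the mono-theta-theoretic ones, for `μ_{2l}`- and `μ`-orbits alike, and the
label-symmetry hypothesis is transported with them. [claim: Mochizuki2012, status: disputed] -/
theorem cor29i_transport {Hbs HGbs : Type v} [AddCommGroup Hbs] [AddCommGroup HGbs] (eH : H ≃+ Hbs)
    (e : HG ≃+ HGbs) (res : LabCusp → (H →+ HG)) (resbs : LabCusp → (Hbs →+ HGbs))
    (hres : ∀ t x, resbs t (eH x) = e (res t x)) (η : H) :
    (∀ t, mu2lOrbit twoL (resbs t (eH η)) = e '' mu2lOrbit twoL (res t η)) ∧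
    (∀ t, muOrbit (resbs t (eH η)) = e '' muOrbit (res t η)) ∧
    ((∀ t t', abs t = abs t' → ∃ σ : H →+ H, res t' = (res t).comp σ ∧ σ η ∈ mu2lOrbit twoL η) →
      ∀ t t', abs t = abs t' →
        ∃ σ : Hbs →+ Hbs, resbs t' = (resbs t).comp σ ∧ σ (eH η) ∈ mu2lOrbit twoL (eH η)) := by
  refine ⟨fun t => ?_, fun t => ?_, fun hsymm t t' htt' => ?_⟩
  · rw [hres]
    exact (image_mu2lOrbit_eq e twoL _).symm
  · rw [hres]
    exact (image_muOrbit_eq e _).symm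
  · obtain ⟨σ, hσres, hσ⟩ := hsymm t t' htt'
    refine ⟨(eH : H →+ Hbs).comp (σ.comp (eH.symm : Hbs →+ H)), ?_, ?_⟩
    · ext y
      obtain ⟨x, rfl⟩ := eH.surjective y
      simp only [AddMonoidHom.comp_apply, AddMonoidHom.coe_coe, AddEquiv.symm_apply_apply]
      rw [hres, hres, hσres, AddMonoidHom.comp_apply]
    · simp only [AddMonoidHom.comp_apply, AddMonoidHom.coe_coe, AddEquiv.symm_apply_apply]
      rw [← image_mu2lOrbit_eq]
      exact ⟨σ η, hσ, rfl⟩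

/-- **IUTchII:Cor2.9(ii)** DISCHARGED modulo its inputs (kurims p. 85): the typed predicate
`Cor29ii_functorialAlgorithm` IS `Cor28ii_functorialAlgorithm` over the base-field-theoretic modules, so the
transport argument of `cor28ii_canonical` applies verbatim ("functorial in the topological group `Π_v`" =
transport along the isomorphisms of coefficient modules induced by `Π_v ⥲ Π'_v`).
[claim: Mochizuki2012, status: disputed] -/
theorem cor29ii_canonical {Conj₁ Conj₂ : Type u} (habs : Function.Surjective abs)
    (res : Conj₁ → Conj₂ → LabCusp → (H →+ HG)) (η : Conj₁ → Conj₂ → H)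
    (res₀ : LabCusp → (H →+ HG)) (η₀ : H)
    (hconj : ∀ γ₁ γ₂ t, ∃ σ : H →+ H, res γ₁ γ₂ t = (res₀ t).comp σ ∧ σ (η γ₁ γ₂) ∈ mu2lOrbit twoL η₀)
    (out : Conj₁ → Conj₂ → LabAbs → Set HG)
    (hout : ∀ γ₁ γ₂ t, out γ₁ γ₂ (abs t) = mu2lOrbit twoL (res γ₁ γ₂ t (η γ₁ γ₂)))
    {H' HG' : Type v} [AddCommGroup H'] [AddCommGroup HG'] (φH : H ≃+ H') (φ : HG ≃+ HG')
    (res' : LabCusp → (H' →+ HG')) (η' : H') (hη' : η' = φH η₀)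
    (hres' : ∀ t x, res' t (φH x) = φ (res₀ t x))
    (out' : LabAbs → Set HG') (hout' : ∀ t, out' (abs t) = mu2lOrbit twoL (res' t η')) :
    Cor29ii_functorialAlgorithm out out' φ :=
  cor28ii_canonical habs res η res₀ η₀ hconj out hout φH φ res' η' hη' hres' out' hout'

/-- **IUTchII:Cor2.9(iii)** DISCHARGED in transport form (kurims p. 85): as `cor28iii_of_transport`, the typed
predicate `Cor29iii_splitting` being `Cor28iii_splitting` with base-field-theoretic cyclotomes.
[claim: Mochizuki2012, status: disputed] -/
theorem cor29iii_of_transport {X U Q X₀ U₀ Q₀ : Type u} (split₀ : X₀ ≃ U₀ × Q₀) (eX : X₀ ≃ X)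
    (eU : U₀ ≃ U) (eQ : Q₀ ≃ Q) :
    Cor29iii_splitting ((eX.symm.trans split₀).trans (eU.prodCongr eQ)) split₀ eX eU eQ :=
  cor28iii_of_transport split₀ eX eU eQ

/-- **IUTchII:Cor2.9(iii)** uniqueness half (kurims p. 85): two splittings compatible with the Cor. 1.12 (ii)
splitting agree on the image of the first restriction operation. [claim: Mochizuki2012, status: disputed] -/
theorem cor29iii_unique {X U Q X₀ U₀ Q₀ : Type u} {split split' : X ≃ U × Q} {split₀ : X₀ ≃ U₀ × Q₀}
    {rX : X₀ → X} {rU : U₀ → U} {rQ : Q₀ → Q} (h : Cor29iii_splitting split split₀ rX rU rQ)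
    (h' : Cor29iii_splitting split' split₀ rX rU rQ) :
    (∀ x₀, split (rX x₀) = split' (rX x₀)) ∧ (Function.Surjective rX → split = split') :=
  cor28iii_unique h h'

/-- **IUTchII:Rmk2.9.1(ii)** for the canonical data (kurims p. 85): the valuation surjection, once it kills the
`2l`-torsion (it does: `ℤ̂` is torsion-free — hypothesis `hkill` as in the statement file), sends the whole orbit
`θ^t_bs = μ_{2l}·res_t(η)` to the single value `V(res_t(η))` ("the values"). [claim: Mochizuki2012, status: disputed] -/
theorem rmk291ii_canonical_value (V : HG →+ Zhat) (hkill : ∀ τ : HG, twoL • τ = 0 → V τ = 0)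
    (res : LabCusp → (H →+ HG)) (η : H) (t : LabCusp) :
    V '' mu2lOrbit twoL (res t η) = {V (res t η)} := by
  apply Set.Subset.antisymm
  · rintro _ ⟨_, ⟨τ, hτ, rfl⟩, rfl⟩
    simp [map_add, hkill τ hτ]
  · rintro _ rfl
    exact ⟨res t η, mem_mu2lOrbit_self twoL _, rfl⟩

end Cor29

end ThetaValueOrbits

end Literature.IUT.HodgeArakelov
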